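import Literature.Computability.QuantumComplexity.Forrelation
import Literature.Computability.Complexity.CircuitComposition
import Literature.Computability.Complexity.NegationElimination

/-!
# Stubs `stub_hardwire`, `stub_codeLength` — hard-wiring inputs of a `B₂`-circuit with a value-independent
# code length, and the quadratic length bound for codes of `B₂`-circuits
# (crux `WbwObfuscatedGluedTrees`, stmt-QuantumAdvantage-2340; line `knowledge-of-walk-split`, stage 3)

* `stub_hardwire`: given a circuit `C` on `M` inputs over `B₂` and a map `ρ : Fin M → Option (Fin m)` (`some p` =
  "old input `i` is the new input `p`", `none` = "old input `i` is the constant `v i`"), the circuit `H v` on `m`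
  inputs consists of an INPUT LAYER with one gate per old input — the arity-`1` copy gate wired to `p`, resp. the
  arity-`0` constant gate `v i` — followed by the gates of `C` relocated behind it (`GateList.reloc`, old input `i`
  ↦ layer gate `i`, old gate `k` ↦ gate `k + M`).  It is over `B₂`, has `M + |C|` gates, computes `C` on the
  substituted input (`GateList.vals_append_reloc`), and its code length does not depend on `v`: the wiring is
  literally independent of `v`, only the (length-`2^0`) truth tables of the constant gates carry `v`.
* `stub_codeLength`: `|encodeCircuit C| ≤ 100 · (n + |C| + 1)²` for `B₂`-circuits on `n` inputs: a wire code has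
  length `≤ n + |C|` (`|encodeNat k| ≤ k`, indices `< n` resp. `< |C|` by well-formedness), a gate code
  `≤ 4 (n + |C|) + 14` (truth table `≤ 4` bits, `≤ 2` wires, `|boolPair a b| = 2|a| + 2 + |b|`), the gate-list code
  `≤ |C| · (8 (n + |C|) + 30)`.
[folklore]
-/

set_option linter.dupNamespace false

namespace Summit.QuantumAdvantage.QuantumAdvantage.Theorems.WbwObfuscatedGluedTrees.KnowledgeOfWalk.Generator

open Literature.Computability.Complexity Literature.Computability.QuantumComplexity
open Literature.Computability.Complexity.GateList Literature.Computability.MetaComplexity Computability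

/-! ## Code lengths -/

/-- `|encodeCodeList l| = 2 Σ |c| + 2 |l|` (each code word is doubled and followed by the separator `01`).
[folklore] -/
private theorem length_encodeCodeList (l : List (List Bool)) :
    (encodeCodeList l).length = 2 * (l.map List.length).sum + 2 * l.length := by
  induction l with
  | nil => rfl
  | cons c l ih =>
    show (boolPair c (encodeCodeList l)).length = _
    rw [length_boolPair, ih]
    simp only [List.map_cons, List.sum_cons, List.length_cons]
    omega

/-- `|encodePosNum p| ≤ p`. [folklore] -/
private theorem length_encodePosNum_le (p : PosNum) : (encodePosNum p).length ≤ (p : ℕ) := by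
  induction p with
  | one => simp [encodePosNum]
  | bit0 p ih =>
    simp only [encodePosNum, List.length_cons, PosNum.cast_bit0]
    have : 0 < (p : ℕ) := PosNum.cast_pos p
    omega
  | bit1 p ih =>
    simp only [encodePosNum, List.length_cons, PosNum.cast_bit1]
    omega

/-- `|encodeNat k| ≤ k` (binary numerals are short). [folklore] -/
private theorem length_encodeNat_le (k : ℕ) : (encodeNat k).length ≤ k := by
  have h : ((k : Num) : ℕ) = k := Num.to_of_nat k
  unfold encodeNat encodeNum
  cases hk : (k : Num) with
  | zero => simp
  | pos p =>
    rw [hk, Num.cast_pos] at h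
    conv_rhs => rw [← h]
    exact length_encodePosNum_le p

/-- A wire of a circuit on `n` inputs referring to gates `< s` only has a code of length `≤ n + s`. [folklore] -/
private theorem length_encodeWire_le {n s : ℕ} (w : Fin n ⊕ ℕ) (hw : ∀ k, w = .inr k → k < s) :
    (encodeWire n w).length ≤ n + s := by
  cases w with
  | inl i =>
    have := length_encodeNat_le (i : ℕ)
    simp only [encodeWire, List.length_cons]
    omega
  | inr k =>
    have := length_encodeNat_le k
    have hk := hw k rfl
    simp only [encodeWire, List.length_cons]
    omega

/-- A `B₂`-gate of a circuit on `n` inputs reading gates `< s` only has a code of length `≤ 4 (n + s) + 14`.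
[folklore] -/
private theorem length_encodeGate_le {n s : ℕ} (g : Gate (Fin n)) (hB : g.fn ∈ B2)
    (hg : ∀ a k, g.args a = .inr k → k < s) : (encodeGate g).length ≤ 4 * (n + s) + 14 := by
  have har : g.arity ≤ 2 := hB
  have hpow : 2 ^ g.arity ≤ 4 := (Nat.pow_le_pow_right (by norm_num) har).trans (by norm_num)
  have hsum : ((List.ofFn fun a => encodeWire n (g.args a)).map List.length).sum ≤ g.arity * (n + s) := by
    have h := List.sum_le_card_nsmul ((List.ofFn fun a => encodeWire n (g.args a)).map List.length) (n + s)
      (fun x hx => by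
        obtain ⟨c, hc, rfl⟩ := List.mem_map.1 hx
        obtain ⟨a, rfl⟩ := List.mem_ofFn.1 hc
        exact length_encodeWire_le _ (hg a))
    simpa using h
  rw [encodeGate, length_boolPair, length_truthTable, length_encodeCodeList, List.length_ofFn]
  have h2 : g.arity * (n + s) ≤ 2 * (n + s) := Nat.mul_le_mul_right _ har
  omega

/-- `|encodeCodeList l| ≤ |l| · (2B + 2)` when every code word has length `≤ B`. [folklore] -/
private theorem length_encodeCodeList_le {l : List (List Bool)} {B : ℕ} (h : ∀ c ∈ l, c.length ≤ B) :
    (encodeCodeList l).length ≤ l.length * (2 * B + 2) := by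
  rw [length_encodeCodeList]
  have hs := List.sum_le_card_nsmul (l.map List.length) B (fun x hx => by
    obtain ⟨c, hc, rfl⟩ := List.mem_map.1 hx
    exact h c hc)
  simp only [List.length_map, smul_eq_mul] at hs
  have : l.length * (2 * B + 2) = 2 * (l.length * B) + 2 * l.length := by ring
  omega

/-- **STUB F′ — the code of a `B₂`-circuit has length quadratic in arity + size**:
`|encodeCircuit C| ≤ 100 · (n + |C| + 1)²` (truth tables of `≤ 4` bits, wire indices `< n + |C|` in binary,
`boolPair` overhead). [folklore] -/
theorem stub_codeLength :
    ∃ c : ℕ, ∀ (n : ℕ) (C : Literature.Computability.Complexity.Circuit (Fin n)), C.IsOver B2 →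
      (encodeCircuit C).length ≤ c * (n + C.size + 1) ^ 2 := by
  refine ⟨100, fun n C hC => ?_⟩
  have hgate : ∀ g ∈ C.gates, (encodeGate g).length ≤ 4 * (n + C.size) + 14 := by
    intro g hg
    obtain ⟨j, hj, rfl⟩ := List.getElem_of_mem hg
    exact length_encodeGate_le _ (hC _ hg) fun a k hk => (C.wf j hj a k hk).trans hj
  have hlist : (encodeCodeList (C.gates.map encodeGate)).length ≤
      C.size * (2 * (4 * (n + C.size) + 14) + 2) := by
    have h := length_encodeCodeList_le (l := C.gates.map encodeGate) (B := 4 * (n + C.size) + 14)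
      (fun c hc => by
        obtain ⟨g, hg, rfl⟩ := List.mem_map.1 hc
        exact hgate g hg)
    rwa [List.length_map] at h
  have hout : (encodeWire n C.output).length ≤ n + C.size := length_encodeWire_le _ C.wf_output
  rw [encodeCircuit, length_boolPair]
  set N := n + C.size with hN
  have hs : C.size ≤ N := by omega
  have h1 : (encodeCodeList (C.gates.map encodeGate)).length ≤ N * (8 * N + 30) :=
    hlist.trans (Nat.mul_le_mul hs (by omega))
  have e1 : (N + 1) ^ 2 = N * N + 2 * N + 1 := by ring
  have e2 : N * (8 * N + 30) = 8 * (N * N) + 30 * N := by ring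
  rw [e1]
  rw [e2] at h1
  omega

/-! ## Hard-wiring -/

/-- Gates reading inputs only evaluate independently of the gates before them. [folklore] -/
private theorem vals_eq_map_of_inputOnly {ι : Type*} (gs : List (Gate ι)) (x : ι → Bool)
    (h : ∀ g ∈ gs, ∀ a k, g.args a ≠ Sum.inr k) :
    vals gs x = gs.map fun g => g.op fun a => wireOf x [] (g.args a) := by
  induction gs using List.reverseRecOn with
  | nil => rfl
  | append_singleton gs g ih =>
    rw [vals_append_singleton, List.map_append, List.map_singleton,
      ih fun g' hg' => h g' (List.mem_append_left _ hg')]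
    congr 2
    refine congrArg g.op (funext fun a => ?_)
    cases hw : g.args a with
    | inl i => rfl
    | inr k => exact absurd hw (h g (by simp) a k)

/-- **The input layer.** For `ρ : Fin M → Option (Fin m)` there is a family `pre v` (`v : Fin M → Bool`) of gate
lists over `B₂` with `M` gates, well formed, whose `i`-th gate carries `(ρ i).elim (v i) x` on input `x`
(copy gate for `ρ i = some p`, constant gate `v i` for `ρ i = none`), and whose list of gate-code lengths does not
depend on `v`. [folklore] -/
private theorem hardwire_pre (M m : ℕ) (ρ : Fin M → Option (Fin m)) :
    ∃ pre : (Fin M → Bool) → List (Gate (Fin m)),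
      (∀ v, (pre v).length = M) ∧ (∀ v, WF (pre v)) ∧ (∀ v, ∀ g ∈ pre v, g.fn ∈ B2) ∧
      (∀ v (x : Fin m → Bool), vals (pre v) x = List.ofFn fun i => (ρ i).elim (v i) x) ∧
      (∀ v v', ((pre v).map encodeGate).map List.length = ((pre v').map encodeGate).map List.length) := by
  -- one gate per old input: its wiring depends on `ρ i` only, its truth table on `v i`
  have key : ∀ o : Option (Fin m), ∃ G : Bool → Gate (Fin m),
      (∀ b j, GateOK j (G b)) ∧ (∀ b, (G b).fn ∈ B2) ∧ (∀ b a k, (G b).args a ≠ Sum.inr k) ∧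
      (∀ b (x : Fin m → Bool), ((G b).op fun a => wireOf x [] ((G b).args a)) = o.elim b x) ∧
      (∀ b b', (encodeGate (G b)).length = (encodeGate (G b')).length) := by
    rintro (_ | p)
    · refine ⟨fun b => ⟨0, fun _ => b, Fin.elim0⟩, fun b j a => a.elim0, fun b => ?_, fun b a => a.elim0,
        fun b x => rfl, fun b b' => ?_⟩
      · show (0 : ℕ) ≤ 2
        omega
      · simp only [encodeGate, length_boolPair, length_truthTable]
    · refine ⟨fun _ => ⟨1, fun y => y 0, fun _ => Sum.inl p⟩, fun b j a k h => (by cases h), fun b => ?_,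
        fun b a k h => (by cases h), fun b x => rfl, fun b b' => rfl⟩
      show (1 : ℕ) ≤ 2
      omega
  choose G hGok hGB hGarg hGval hGcode using key
  refine ⟨fun v => List.ofFn fun i => G (ρ i) (v i), fun v => List.length_ofFn, fun v => ?_, fun v => ?_,
    fun v x => ?_, fun v v' => ?_⟩
  · intro j g hj
    obtain ⟨i, rfl⟩ := List.mem_ofFn.1 (List.mem_of_getElem? hj)
    exact hGok _ _ _
  · intro g hg
    obtain ⟨i, rfl⟩ := List.mem_ofFn.1 hg
    exact hGB _ _
  · rw [vals_eq_map_of_inputOnly _ _ fun g hg => by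
      obtain ⟨i, rfl⟩ := List.mem_ofFn.1 hg
      exact hGarg _ _, List.map_ofFn]
    exact congrArg List.ofFn (funext fun i => hGval _ _ _)
  · rw [List.map_ofFn, List.map_ofFn, List.map_ofFn, List.map_ofFn]
    exact congrArg List.ofFn (funext fun i => hGcode _ _ _)

/-- **STUB F — hard-wiring inputs of a `B₂`-circuit with a value-independent code length.**  For a circuit `C` on
`M` inputs and a map `ρ` sending each input either to one of `m` new inputs or to "constant", there is a family `H v`
(`v` the constant values) of `B₂`-circuits on `m` inputs computing `C` on the substituted input, of size `≤ |C| + M`,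
whose CODE LENGTH does not depend on `v`: the input layer of `hardwire_pre` followed by the gates of `C` relocated
behind it (`GateList.reloc`, `GateList.vals_append_reloc`). [folklore] -/
theorem stub_hardwire :
    ∀ (M m : ℕ) (ρ : Fin M → Option (Fin m)) (C : Literature.Computability.Complexity.Circuit (Fin M)), C.IsOver B2 →
      ∃ H : (Fin M → Bool) → Literature.Computability.Complexity.Circuit (Fin m),
        (∀ v, (H v).IsOver B2) ∧ (∀ v, (H v).size ≤ C.size + M) ∧
        (∀ v x, (H v).eval x = C.eval (fun i => (ρ i).elim (v i) x)) ∧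
        (∀ v v', (encodeCircuit (H v)).length = (encodeCircuit (H v')).length) := by
  intro M m ρ C hC
  obtain ⟨pre, hlen, hwf, hB, hval, hcode⟩ := hardwire_pre M m ρ
  -- the old inputs are wired to the gates of the input layer
  set σ : Fin M → Fin m ⊕ ℕ := fun i => Sum.inr (i : ℕ) with hσ
  have hσM : WiresOK M σ := fun i k hk => by
    simp only [hσ, Sum.inr.injEq] at hk
    omega
  have hσok : ∀ v, WiresOK (pre v).length σ := fun v => by
    rw [hlen]
    exact hσM
  have hWF : ∀ v, WF (pre v ++ C.gates.map (reloc σ M)) := fun v => by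
    have h := (hwf v).append_reloc (wf_gates C) (hσok v)
    rwa [hlen v] at h
  have hout : ∀ v k, shiftWire σ M C.output = Sum.inr k → k < (pre v ++ C.gates.map (reloc σ M)).length := by
    intro v k hk
    rw [List.length_append, List.length_map, hlen]
    cases hco : C.output with
    | inl i =>
      rw [hco] at hk
      simp only [shiftWire, hσ, Sum.inr.injEq] at hk
      omega
    | inr k' =>
      rw [hco] at hk
      simp only [shiftWire, Sum.inr.injEq] at hk
      have := C.wf_output k' hco
      omega
  refine ⟨fun v => toCircuit (pre v ++ C.gates.map (reloc σ M)) (shiftWire σ M C.output) (hWF v) (hout v),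
    fun v => ?_, fun v => ?_, fun v x => ?_, fun v v' => ?_⟩
  · -- over `B₂`
    intro g hg
    change g ∈ pre v ++ C.gates.map (reloc σ M) at hg
    rcases List.mem_append.1 hg with h | h
    · exact hB v g h
    · obtain ⟨g', hg', rfl⟩ := List.mem_map.1 h
      rw [reloc_fn]
      exact hC g' hg'
  · -- size
    show (pre v ++ C.gates.map (reloc σ M)).length ≤ C.gates.length + M
    rw [List.length_append, List.length_map, hlen]
    omega
  · -- value
    rw [circuit_eval, circuit_eval]
    show wireOf x (vals (pre v ++ C.gates.map (reloc σ M)) x) (shiftWire σ M C.output) = _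
    have hv : vals (pre v ++ C.gates.map (reloc σ M)) x =
        vals (pre v) x ++ vals C.gates (fun i => wireOf x (vals (pre v) x) (σ i)) := by
      have h := vals_append_reloc (pre v) C.gates σ (hσok v) x
      rwa [hlen v] at h
    have hy : (fun i => wireOf x (vals (pre v) x) (σ i)) = fun i => (ρ i).elim (v i) x := by
      funext i
      simp only [hσ, wireOf_inr, hval]
      rw [List.getD_eq_getElem _ _ (by simp), List.getElem_ofFn]
    rw [hv, wireOf_shiftWire x _ _ ((length_vals _ _).trans (hlen v)) σ hσM, hy]
  · -- code length
    simp only [encodeCircuit, toCircuit, length_boolPair, length_encodeCodeList, List.map_append, List.map_map,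
      List.sum_append, List.length_append, List.length_map, hlen]
    rw [← List.map_map, hcode v v', List.map_map]

end Summit.QuantumAdvantage.QuantumAdvantage.Theorems.WbwObfuscatedGluedTrees.KnowledgeOfWalk.Generator
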